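import Mathlib

/-!
# Stub S2 (`stub_card_le_of_algebraicIndependent`), crux stmt-ValiantsHypothesis-6625, line `Sketch`

The transcendence-degree count of Kalorkoti's argument: an algebraically independent family over
`ℂ` lying inside the `ℂ`-subalgebra of `ℂ[x_τ]` generated by a finite set `s` has at most
`s.card` members (pull back along `MvPolynomial.aeval ((↑) : ↥s → ℂ[x_τ])`, then
`trdeg ℂ ℂ[T_s] = #s`).  Mathlib only.
-/

open MvPolynomial

-- `Summit.ValiantsHypothesis.ValiantsHypothesis.…` is the tree's mandated single-conjunct layout.
set_option linter.dupNamespace false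

namespace Summit.ValiantsHypothesis.ValiantsHypothesis.Theorems.ElementaryWordLengthWordPerCubic

/-- **S2 — transcendence-degree count.** If `c : ι → ℂ[x_τ]` is algebraically independent over
`ℂ` and every `c i` lies in the `ℂ`-subalgebra generated by the finite set `s`, then `|ι| ≤ |s|`:
writing `c i = aeval (↑) (P i)` with `P i ∈ ℂ[T_s]` (`Algebra.adjoin_eq_range`), the family `P`
is algebraically independent (`AlgebraicIndependent.of_comp`), so `#ι ≤ trdeg ℂ ℂ[T_s] = #s`
(`AlgebraicIndependent.cardinalMk_le_trdeg`, `MvPolynomial.trdeg_of_isDomain`). [folklore] -/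
theorem stub_card_le_of_algebraicIndependent {ι τ : Type} [Fintype ι]
    (s : Finset (MvPolynomial τ ℂ)) (c : ι → MvPolynomial τ ℂ)
    (hc : AlgebraicIndependent ℂ c)
    (hmem : ∀ i, c i ∈ Algebra.adjoin ℂ (↑s : Set (MvPolynomial τ ℂ))) :
    Fintype.card ι ≤ s.card := by
  have hex : ∀ i, ∃ P : MvPolynomial (↑s : Set (MvPolynomial τ ℂ)) ℂ,
      aeval ((↑) : (↑s : Set (MvPolynomial τ ℂ)) → MvPolynomial τ ℂ) P = c i := by
    intro i
    have h := hmem i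
    rw [Algebra.adjoin_eq_range, AlgHom.mem_range] at h
    exact h
  choose P hP using hex
  have hPi : AlgebraicIndependent ℂ P := by
    refine AlgebraicIndependent.of_comp
      (aeval ((↑) : (↑s : Set (MvPolynomial τ ℂ)) → MvPolynomial τ ℂ)) ?_
    have hcomp :
        ⇑(aeval ((↑) : (↑s : Set (MvPolynomial τ ℂ)) → MvPolynomial τ ℂ)) ∘ P = c :=
      funext hP
    rw [hcomp]
    exact hc
  have h1 := hPi.cardinalMk_le_trdeg
  rw [MvPolynomial.trdeg_of_isDomain, Cardinal.mk_fintype, Finset.coe_sort_coe,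
    Cardinal.mk_coe_finset, Cardinal.lift_natCast, Nat.cast_le] at h1
  exact h1

end Summit.ValiantsHypothesis.ValiantsHypothesis.Theorems.ElementaryWordLengthWordPerCubic
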